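import Mathlib.Analysis.SpecialFunctions.Pow.Real
import Mathlib.Algebra.BigOperators.NatAntidiagonal
import Mathlib.Algebra.BigOperators.Intervals
import Mathlib.Algebra.BigOperators.Field
import Summits.CriticalPhenomena.PercolationContinuityZ3.Theorems.PercNearOneGluingNoHeavyLowerTailLogConcaveCycles
import HarnessLib

/-!
# Exchangeable pattern laws with one distinguished point: the sequence core of Theorem C1

Support file for the Sahi / Conjecture-P programme of route `PercNearOneGluingNoHeavy`
(`--supports stmt-CriticalPhenomena-4575`, prover prim-l12-p5 gen 24; proof note
`prim-l12-p5/FRESH-CYCLE-g24.md` §6, Theorem C1).  No definitions, no named facts, no sorries.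

## Setting (note §6)

A pattern law on `Y = O ⊔ {p₀}` invariant under all permutations of the ordinary points `O`.
`h(b) = X(b,0)` is the coverage value of `b` ordinary points, `X₁(b) = X(b,1)` that of `b` ordinary
points together with the special point `p₀`; `u_a = Z(a,0)/a!` (`∑ u_a x^a = exp ∑ h(j)x^j/j`) and
`w_a = Z(a,1)/a! = ∑_{b ≤ a} X₁(b) u_{a-b}` are the normalised partition functions of `a` ordinary
points without / with `p₀`, and `U_k = ∑_{s ≤ k} u_s` (`k! U_k` = partition function of `k` ordinary
points plus a FREE root).  By the Bender–Canfield theorem applied to the log-concave sequence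
`(1, h(1)+1, h(2)+1, …)` the sequence `U` is log-concave; everything below is downstream of that
single hypothesis `hlc`.

## Results

* `t_mono`      : `u_{a+1} U_a ≤ u_a U_{a+1}`  (the free-root ratio `U_a/u_a` is nondecreasing);
* `ratio_chain` : `U_{a+1} U_k ≤ U_a U_{k+1}` for `k ≤ a`;
* `gt_mono`     : `u_{a+1} U_k ≤ u_a U_{k+1}` for `k ≤ a`  (all tail sums of the Q-MONO expansion);
* `q_mono`      : for `X₁ ≥ 0` nondecreasing, `w_a u_{a+1} ≤ w_{a+1} u_a`, i.e. the ratio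
  `Q_a = Z(a,1)/Z(a,0)` of partition functions with / without the special point is nondecreasing
  in the number of ordinary points ("mixed log-supermodularity");
* `x_ineq`      : the coverage-side inequality `(j+1) X(j+2,0) X(j+1,1) ≤ (j+2) X(j+2,1) X(j+1,0)`
  from concavity of `h`, antitonicity of `g = X₁ − h` and `g(b-1) − g(b) ≤ h(b) − h(b-1)`;
* `tp2_grid`    : the two combine to the TP₂ (log-supermodularity) condition of the law of
  `(#ordinary points, [p₀ ∈ ·])` of the cycle of a generic point on the grid `[0,M] × {0,1}`,
  which by the FKG inequality on that distributive lattice gives GC-FINER for the class (note §6).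
-/

namespace Summit.CriticalPhenomena.PercolationContinuityZ3.Theorems

namespace SpecialPointGrid

open Finset

variable {u U : ℕ → ℝ}

/-- **(T)** If `U` (the partial sums of `u`, `U_0 = u_0`) is positive and log-concave then
`u_{a+1} U_a ≤ u_a U_{a+1}`: the ratio `U_a / u_a` is nondecreasing. -/
theorem t_mono (hU0 : U 0 = u 0) (hUs : ∀ k, U (k + 1) = U k + u (k + 1)) (hUpos : ∀ k, 0 < U k)
    (hlc : ∀ k, U k * U (k + 2) ≤ U (k + 1) * U (k + 1)) :
    ∀ a, u (a + 1) * U a ≤ u a * U (a + 1) := by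
  intro a
  rcases a with _ | a
  · show u 1 * U 0 ≤ u 0 * U 1
    have h1 : U 1 = U 0 + u 1 := hUs 0
    have h0 := hUpos 0
    rw [h1, ← hU0]
    nlinarith [h0]
  · have e1 : u (a + 1) = U (a + 1) - U a := by have := hUs a; linarith
    have e2 : u (a + 2) = U (a + 2) - U (a + 1) := by have := hUs (a + 1); linarith
    rw [e1, e2]
    nlinarith [hlc a]

/-- Log-concavity iterated: `U_{a+1} U_k ≤ U_a U_{k+1}` for `k ≤ a`
(the consecutive ratios `U_{k+1}/U_k` are nonincreasing). -/
theorem ratio_chain (hUpos : ∀ k, 0 < U k)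
    (hlc : ∀ k, U k * U (k + 2) ≤ U (k + 1) * U (k + 1)) :
    ∀ k a, k ≤ a → U (a + 1) * U k ≤ U a * U (k + 1) := by
  intro k a hka
  induction a, hka using Nat.le_induction with
  | base => exact le_of_eq (by ring)
  | succ a hka ih =>
    -- U_{a+2} U_k U_{a+1} ≤ U_{a+2} U_a U_{k+1} ≤ U_{a+1}^2 U_{k+1}
    have h1 : U (a + 2) * U k * U (a + 1) ≤ U (a + 2) * (U a * U (k + 1)) := by
      have := mul_le_mul_of_nonneg_left ih (hUpos (a + 2)).le
      linarith
    have h2 : U (a + 2) * (U a * U (k + 1)) ≤ U (a + 1) * U (a + 1) * U (k + 1) := by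
      have := mul_le_mul_of_nonneg_right (hlc a) (hUpos (k + 1)).le
      linarith
    have h3 : (U (a + 2) * U k) * U (a + 1) ≤ (U (a + 1) * U (k + 1)) * U (a + 1) := by linarith
    exact le_of_mul_le_mul_right h3 (hUpos (a + 1))

/-- **(GT)** `u_{a+1} U_k ≤ u_a U_{k+1}` for `k ≤ a`: all tail sums of the Q-MONO expansion are
nonnegative. -/
theorem gt_mono (hU0 : U 0 = u 0) (hUs : ∀ k, U (k + 1) = U k + u (k + 1)) (hUpos : ∀ k, 0 < U k)
    (hupos : ∀ k, 0 < u k)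
    (hlc : ∀ k, U k * U (k + 2) ≤ U (k + 1) * U (k + 1)) :
    ∀ k a, k ≤ a → u (a + 1) * U k ≤ u a * U (k + 1) := by
  intro k a hka
  have hT := t_mono hU0 hUs hUpos hlc a
  have hR := ratio_chain hUpos hlc k a hka
  -- u_{a+1} U_a U_k ≤ u_a U_{a+1} U_k ≤ u_a U_a U_{k+1}
  have h1 : u (a + 1) * U a * U k ≤ u a * U (a + 1) * U k :=
    mul_le_mul_of_nonneg_right hT (hUpos k).le
  have h2 : u a * U (a + 1) * U k ≤ u a * (U a * U (k + 1)) := by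
    have := mul_le_mul_of_nonneg_left hR (hupos a).le
    linarith
  have h3 : (u (a + 1) * U k) * U a ≤ (u a * U (k + 1)) * U a := by linarith
  exact le_of_mul_le_mul_right h3 (hUpos a)

/-! ### Q-MONO by Abel summation -/

/-- The tail sums of `D_k := u_{a+1-k} u_a − u_{a-k} u_{a+1}` (`k ≤ a`), `D_{a+1} := u_0 u_a`:
`∑_{k' ≥ k} D_{k'} = u_a U_{a+1-k} − u_{a+1} U_{a-k}` — stated through the reflected index
`i = a + 1 − k` as an identity of initial partial sums. -/
theorem reflected_partial_sum (hU0 : U 0 = u 0) (hUs : ∀ k, U (k + 1) = U k + u (k + 1)) (a : ℕ) :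
    ∀ K, K ≤ a + 1 →
      ∑ i ∈ range (K + 1), (if i = 0 then u 0 * u a else u i * u a - u (i - 1) * u (a + 1)) =
        u a * U K - u (a + 1) * (if K = 0 then 0 else U (K - 1)) := by
  intro K hK
  induction K with
  | zero => simp [hU0, mul_comm]
  | succ K ih =>
    rw [Finset.sum_range_succ, ih (by omega)]
    rcases K with _ | K
    · have h1 : U 1 = U 0 + u 1 := hUs 0
      simp [hU0, h1]
      ring
    · simp only [Nat.succ_ne_zero, if_false, Nat.add_sub_cancel]
      rw [hUs (K + 1), hUs K]
      ring

/-- **(Q-MONO)** For `X₁ ≥ 0` nondecreasing and `U` positive log-concave: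
`w_a u_{a+1} ≤ w_{a+1} u_a` with `w_a = ∑_{b ≤ a} X₁(b) u_{a-b}`, i.e. `Z(a,1)/Z(a,0)` is nondecreasing
in `a`. -/
theorem q_mono (hU0 : U 0 = u 0) (hUs : ∀ k, U (k + 1) = U k + u (k + 1)) (hUpos : ∀ k, 0 < U k)
    (hupos : ∀ k, 0 < u k)
    (hlc : ∀ k, U k * U (k + 2) ≤ U (k + 1) * U (k + 1))
    (X₁ : ℕ → ℝ) (hX0 : ∀ b, 0 ≤ X₁ b) (hXmono : ∀ b, X₁ b ≤ X₁ (b + 1)) (a : ℕ) :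
    (∑ b ∈ range (a + 1), X₁ b * u (a - b)) * u (a + 1) ≤
      (∑ b ∈ range (a + 2), X₁ b * u (a + 1 - b)) * u a := by
  -- difference = ∑_{k ≤ a+1} X₁ k D_k with D as in `reflected_partial_sum` (index i = a+1-k)
  set D : ℕ → ℝ := fun i => if i = 0 then u 0 * u a else u i * u a - u (i - 1) * u (a + 1) with hD
  have hdiff : (∑ b ∈ range (a + 2), X₁ b * u (a + 1 - b)) * u a -
      (∑ b ∈ range (a + 1), X₁ b * u (a - b)) * u (a + 1) =
      ∑ i ∈ range (a + 2), X₁ (a + 1 - i) * D i := by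
    -- reflect the index in both sums
    have r1 : ∑ b ∈ range (a + 2), X₁ b * u (a + 1 - b) =
        ∑ i ∈ range (a + 2), X₁ (a + 1 - i) * u i := by
      rw [← Finset.sum_range_reflect (fun b => X₁ b * u (a + 1 - b)) (a + 2)]
      refine Finset.sum_congr rfl fun i hi => ?_
      rw [Finset.mem_range] at hi
      simp only [show a + 2 - 1 - i = a + 1 - i by omega, show a + 1 - (a + 1 - i) = i by omega]
    have r2 : ∑ b ∈ range (a + 1), X₁ b * u (a - b) =
        ∑ i ∈ range (a + 1), X₁ (a - i) * u i := by
      rw [← Finset.sum_range_reflect (fun b => X₁ b * u (a - b)) (a + 1)]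
      refine Finset.sum_congr rfl fun i hi => ?_
      rw [Finset.mem_range] at hi
      simp only [show a + 1 - 1 - i = a - i by omega, show a - (a - i) = i by omega]
    -- named pieces
    have eL : (∑ i ∈ range (a + 2), X₁ (a + 1 - i) * u i) * u a =
        (∑ i ∈ range (a + 1), X₁ (a - i) * u (i + 1) * u a) + X₁ (a + 1) * u 0 * u a := by
      rw [Finset.sum_range_succ' (fun i => X₁ (a + 1 - i) * u i) (a + 1), add_mul, Finset.sum_mul]
      congr 1
      refine Finset.sum_congr rfl fun i hi => ?_
      rw [show a + 1 - (i + 1) = a - i by omega]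
    have eL2 : (∑ i ∈ range (a + 1), X₁ (a - i) * u i) * u (a + 1) =
        ∑ i ∈ range (a + 1), X₁ (a - i) * u i * u (a + 1) := by rw [Finset.sum_mul]
    have eR : ∑ i ∈ range (a + 2), X₁ (a + 1 - i) * D i =
        (∑ i ∈ range (a + 1), X₁ (a - i) * (u (i + 1) * u a - u i * u (a + 1))) +
          X₁ (a + 1) * (u 0 * u a) := by
      rw [Finset.sum_range_succ' (fun i => X₁ (a + 1 - i) * D i) (a + 1)]
      simp only [hD, Nat.succ_ne_zero, if_false, if_true, Nat.add_sub_cancel, Nat.sub_zero]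
      congr 1
      refine Finset.sum_congr rfl fun i hi => ?_
      rw [show a + 1 - (i + 1) = a - i by omega]
    have eS : ∑ i ∈ range (a + 1), X₁ (a - i) * (u (i + 1) * u a - u i * u (a + 1)) =
        (∑ i ∈ range (a + 1), X₁ (a - i) * u (i + 1) * u a) -
          ∑ i ∈ range (a + 1), X₁ (a - i) * u i * u (a + 1) := by
      rw [← Finset.sum_sub_distrib]
      exact Finset.sum_congr rfl fun i _ => by ring
    rw [r1, r2, eL, eL2, eR, eS]
    ring
  -- Abel summation on the reflected sequence: λ_i := X₁(a+1-i) is nonincreasing in i and ≥ 0,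
  -- and the initial partial sums of D are ≥ 0 by (GT) / `reflected_partial_sum`.
  have hP : ∀ K, K ≤ a + 1 + 1 → 0 ≤ ∑ i ∈ range K, D i := by
    intro K hK
    rcases K with _ | K
    · simp
    · have key := reflected_partial_sum hU0 hUs a K (by omega)
      have hrw : ∑ i ∈ range (K + 1), D i =
          u a * U K - u (a + 1) * (if K = 0 then 0 else U (K - 1)) := by
        rw [← key]
      rw [hrw]
      rcases K with _ | K
      · simp only [if_true, mul_zero, sub_zero]
        exact mul_nonneg (hupos a).le (hUpos 0).le
      · simp only [Nat.succ_ne_zero, if_false, Nat.add_sub_cancel]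
        have := gt_mono hU0 hUs hUpos hupos hlc K a (by omega)
        linarith
  have habel := LogConcaveCycles.abel_nonneg (fun i => X₁ (a + 1 - i)) D (a + 1)
    (by
      intro i hi
      show X₁ (a + 1 - (i + 1)) ≤ X₁ (a + 1 - i)
      rw [show a + 1 - i = (a + 1 - (i + 1)) + 1 by omega]
      exact hXmono _)
    (fun i => hX0 _) hP
  linarith [hdiff, habel]

/-! ### The coverage-side inequality and the TP₂ condition on the grid -/

/-- **(X-inequality).**  With `h₁ = h(j+1)`, `h₂ = h(j+2)` (coverage values of `j+1`, `j+2` ordinary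
points; `(j+1) h₂ ≤ (j+2) h₁` is concavity from the origin), `g₁ = g(j+1) ≥ g₂ = g(j+2) ≥ 0` the
increments due to the special point (`g(b) = X(b,1) − X(b,0)`), and `g₁ − g₂ ≤ h₂ − h₁`:
`(j+1) · X(j+2,0) · X(j+1,1) ≤ (j+2) · X(j+2,1) · X(j+1,0)`. -/
theorem x_ineq (j : ℕ) (h₁ h₂ g₁ g₂ : ℝ) (hh₁ : 0 ≤ h₁) (hg₂ : 0 ≤ g₂) (hg : g₂ ≤ g₁)
    (hconc : ((j : ℝ) + 1) * h₂ ≤ ((j : ℝ) + 2) * h₁) (hcross : g₁ - g₂ ≤ h₂ - h₁) :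
    ((j : ℝ) + 1) * h₂ * (h₁ + g₁) ≤ ((j : ℝ) + 2) * (h₂ + g₂) * h₁ := by
  -- (j+1) h₂ g₁ ≤ (j+2) h₁ g₁ and h₁ [h₂ − (j+2)(g₁−g₂)] ≥ h₁ [(j+2) h₁ − (j+1) h₂] ≥ 0
  have hg₁ : 0 ≤ g₁ := hg₂.trans hg
  have hj : (0 : ℝ) ≤ (j : ℝ) := Nat.cast_nonneg j
  nlinarith [mul_le_mul_of_nonneg_right hconc hg₁, mul_le_mul_of_nonneg_left hcross hh₁,
    mul_nonneg hh₁ hg₂, mul_nonneg (mul_nonneg hj hh₁) hg₂, mul_nonneg hh₁ (sub_nonneg.2 hg)]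

/-- **(TP₂ on the grid).**  If the partition-function ratio is mixed log-supermodular,
`Z(a-1,1) Z(a,0) ≤ Z(a,1) Z(a-1,0)` (`q_mono`), and the coverage-side inequality `x_ineq` holds,
then the (unnormalised) law `ρ(j,ε) ∝ C(M,j) (j+ε)! X(j+1,ε) Z(M-j,1-ε)` of
`(#ordinary cycle-mates, [p₀ is a cycle-mate])` of a generic point satisfies
`ρ(j+1,0) ρ(j,1) ≤ ρ(j+1,1) ρ(j,0)` — the log-supermodularity condition on `[0,M] × {0,1}`.
Here `a = M − j`, all binomial and factorial factors are collected in the common positive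
constant `c`, and `(j+2)`, `(j+1)` are the surviving factorial ratios. -/
theorem tp2_grid (j : ℕ) (c X20 X21 X10 X11 Za1 Za0 Zb1 Zb0 : ℝ)
    (hc : 0 ≤ c) (hX20 : 0 ≤ X20) (hX11 : 0 ≤ X11) (hZa0 : 0 ≤ Za0) (hZb1 : 0 ≤ Zb1)
    (hQ : Zb1 * Za0 ≤ Za1 * Zb0)
    (hX : ((j : ℝ) + 1) * X20 * X11 ≤ ((j : ℝ) + 2) * X21 * X10) :
    (c * ((j : ℝ) + 1) * X20 * Zb1) * (c * X11 * Za0) ≤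
      (c * ((j : ℝ) + 2) * X21 * Zb0) * (c * X10 * Za1) := by
  have h1 : 0 ≤ ((j : ℝ) + 1) * X20 * X11 := by positivity
  have h2 : 0 ≤ Zb1 * Za0 := mul_nonneg hZb1 hZa0
  have := mul_le_mul hX hQ h2 (h1.trans hX)
  have hc2 : 0 ≤ c * c := mul_nonneg hc hc
  have := mul_le_mul_of_nonneg_left this hc2
  nlinarith [this]

end SpecialPointGrid

end Summit.CriticalPhenomena.PercolationContinuityZ3.Theorems
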